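import Literature.MathematicalPhysics.QuantumFieldTheory.Balaban1983to89.B6Dg288ChartV1
import Literature.MathematicalPhysics.QuantumFieldTheory.Balaban1983to89.B6Prop22AdjMultiLevelTorus
import Literature.MathematicalPhysics.QuantumFieldTheory.Balaban1983to89.B6RandomWalkHom

/-!
# `Balaban1983to89.B6ScalarFactorsChartV1` — T. Bałaban, *Propagators and renormalization transformations for lattice gauge theories. II*,
# Commun. Math. Phys. **96** (1984) 223–250 [Balaban1984PropagatorsII], (2.17) p. 225 `P = G′Q′*(Q′G′²Q′*)⁻¹Q′G′`, Prop. 2.2 (2.67) p. 234,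
# Prop. 2.3 (2.87) p. 238: **THE SCALAR FACTORS `G′`, `∂G′`, `G′∂*`, `S := Q′*(Q′G′²Q′*)⁻¹Q′` OF THE PROJECTION (2.17) ON THE V1 TORUS, WITH
# THEIR (2.67)/(2.87) BLOCK MAJORANTS** — p21's torus matrices `gmlT`, `∂_μ·gmlT`, `gmlT·∂_νᵀ`, `QsM·GiM·QM` READ ON THE V1 SITE FUNCTIONS
# through gen 19's identity chart, the identities `G′Δ′_a = 1`, `P = I − R = G′SG′`, `S·G′²·S = S`, and ONE threshold for all four majorants:
# the DISPLAYED INPUTS of the line-3 domain-change estimate of (2.92) (p38's `B6DomainChangeP2134` + sizes) for the GLOBAL `P` of ROUTE V,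
# and — applied to the member family `B6MemberTorusTDomainsV1.famOf` — for the member `P_□`

statement-level skeleton of published theorems with citation tags; proofs where landed; nothing here is a claim about the Yang–Mills mass gap

PDF held: `paper:balaban1984-cmp96-propagators-rt-ii` (journal page = PDF page + 222); p. 225 [PDF 3] ((2.13)–(2.17)), p. 234 [PDF 12] ((2.67)), p. 235
[PDF 13] ((2.68)–(2.69)), p. 238 [PDF 16] ((2.86)–(2.88)), p. 239 [PDF 17] ((2.90)–(2.92)) re-read from the materialised text
`~/.lit/texts/paper-balaban1984-cmp96-propagators-rt-ii/p0003.txt`, `p0012.txt`, `p0013.txt`, `p0016.txt`, `p0017.txt` (this seat, 2026-08-23).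

PRINT (verbatim up to notation).  p. 225: *"The first equation gives λ = Δ′_a⁻¹f − Δ′_a⁻²Q′*ω = G′f − G′²Q′*ω … hence Rf = Δλ = Δ′_aλ = f −
G′Q′*(Q′G′²Q′*)⁻¹Q′G′f. (2.17) The operator G′ = Δ′_a⁻¹ is a well defined, positive operator"*; p. 234: *"Proposition 2.2. If we have (2.1), (2.2) and
M is sufficiently large, then the operator G′ = Δ′_a⁻¹ (a = 1) satisfies the inequalities |(G′λ)(x)|, |(∇^ηG′λ)(x)|, |(G′∇^η*λ)(x)|, … ≤
O(1)(L^jη)²e^{−δ₀d(y,y′)}|λ|, O(1)L^jη e^{−δ₀d(y,y′)}|λ|, O(1)L^jη e^{−δ₀d(y,y′)}|λ| … x ∈ B^j(y), supp λ ⊂ B^{j′}(y′) (2.67)"*; p. 238: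
*"Proposition 2.3. An inverse of the operator Q′G′²Q′* is given by the convergent expansion (Q′G′²Q′*)⁻¹ = C(I − R)⁻¹ = Σ CRⁿ (2.86) and it
satisfies the estimate |(Q′G′²Q′*)⁻¹(y, y′)| ≤ O(1)(L^jη)^{−4}(L^{j′}η)^{−d}e^{−δ₁d(y,y′)}, y ∈ Λ_j, y′ ∈ Λ_{j′}. (2.87)"*; p. 239 (2.92):
*"(ζ_□(∂P∂* − ∂P_□∂*)h_□A)_μ(x)"* (line 3).

CITATION HEADER (lean-in-tree rule) — WHAT IS REPRODUCED.  Phase-2 file of the `lit-balaban` typed skeleton (HOME `run/shared/lean/pub/lit-balaban/`),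
seat **p22 gen 20** (free-target protocol G.5-34(d): TAKING line HOME/STATUS.md 2026-08-23T04:33Z «(d4-iii) the concrete scalar factors of (2.92)
line 3»; B6 fold owner r03 (04:28Z/04:42Z: «please take it»; carrier = V1 `onFun` ring over `domT`), consumer p38 g27 (`B6DomainChangeP2134Sizes`,
displayed-input shapes of 04:14Z: `HasMajorant blkS G (B₁·len²·e^{−δd})`, `HasMajorantHom blkS blkY (EL₀ ∘ G) (C₁·len·e^{−δd})`,
`HasMajorantHom blkY blkS (G ∘ ER₀) (…)`, `HasMajorant blkS S (B_S·len⁻⁴·e^{−δd})`, ring data `GD = DG = 1`, hS1, hS2), referee ref-4); SKELETON rows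
**B6.Eq2.17** × **B6.Prop2.2** × **B6.Prop2.3** × **B6.Eq2.91** (cells only; decls of record untouched: the torus theorems are p21's
`prop22_first/second/third_multiLevelTorus`, `prop23_multiLevelTorus`; the V1 `R` chart is gen 19's `B6Dg288ChartV1.RE_eq_rM_chart`).
* §1 **`chartOp hN M`** — a torus matrix as an operator on the V1 site functions `Site (PV …) 0 → ℝ` (`(M̂f)(x) = (M·(f∘chart⁻¹))(toBox x)`);
  multiplicative, unital, linear (`chartOp_mul/one/add/smul/sub`); `onFun_eq_chartOp` (an `ℓ²` operator given pointwise by a matrix IS `M̂`).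
* §2 transport of majorants: `hasMajorant_chartOp` (sites, block map `blkS := blkOf ∘ toBox`), `dE_chartOp_apply`/**`hasMajorantHom_dE_chartOp`**
  (left leg `∂_c ∘ M̂`: sites → bonds, from the torus majorants of `∂_μM`, `∂_μ = S_{e_μ} − 1` p21's `dT`), `chartOp_dsE_apply`/
  **`hasMajorantHom_chartOp_dsE`** (right leg `M̂ ∘ ∂_c*`: bonds → sites, from the majorants of `M·∂_νᵀ`, factor `d + 1` for the directions).
* §3 the factors **`DpV`** (`Δ′_a = c²·mlOpT̂`), **`GpV`** (`G′ = c⁻²·gmlT̂`), **`SV`** (`S = c⁴·(QsM·GiM·QM)̂`) and the identities `GpV_mul_DpV`,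
  `DpV_mul_GpV` (`G′Δ′_a = Δ′_aG′ = 1`), **`onFun_oneSubRE_eq`** (`onFun (id − RE (domT hN D hk) c) = GpV * SV * GpV`: Sect. A's `I − R` IS the
  five-factor `G′SG′`), `SV_mul_GpV_sq_mul_SV` (`S·G′²·S = S`), `GpV_SV_mul_GpV_sq_mul_SV`, `GSG_idem` (`P² = P`), `S_entry`
  (`S(x, x′) = GiM(y(x), y(x′))/W(y(x′))`).
* §4 p21's theorems at the printed weights `aPrinted ℓ 1`, ONE threshold `M₁ ≤ L·M_h` (absorbing `M_h ≥ 3`, (2.59), «M sufficiently large»):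
  **`prop22_entries_printed`** ((2.67)₁₂₃: majorants `C·L^{2j}e^{−δd}`, `C·L^{j}e^{−δd}`, `C·L^{j}e^{−δd}` of `GT`, `dT μ·GT`, `GT·(dT μ)ᵀ`),
  **`prop23_GiM_printed`** ((2.87): `|GiM(y, y′)| ≤ C·(L^j)^{−4}·e^{−δd}`), **`hasMajorant_S_matrix`** (the majorant `C·(L^j)^{−4}e^{−δd}` of
  `QsM·GiM·QM`, summing over the `≤ W(y′)` sites of `B(y′)`).
* §5 **`factors_V1`** / `factors_V1_TB`: ∃ `M₁, δ, C > 0` (on `d, L`) such that for every V1 global torus (`hN`), every `D : TDomains` with `P_μ ≥ 4`,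
  `R ≥ 2L`, `M₁ ≤ L·M_h` and every `c ≠ 0`: `HasMajorant blkS GpV ((c²)⁻¹·C·len²·e^{−δd})`, `HasMajorantHom blkS blkV1 (onFun (dE c) ∘ GpV)
  (|c|⁻¹·C·len·e^{−δd})`, `HasMajorantHom blkV1 blkS (GpV ∘ onFun (dsE c)) ((d+1)|c|⁻¹·C·len·e^{−δd})`, `HasMajorant blkS SV (c⁴·C·len⁻⁴·e^{−δd})`
  on `geomT D` (resp. `geomTB D`).
THEOREMS + transparent definitions with bodies (`chartOp`, `comp`, `blkS`, `DpV`, `GpV`, `SV`; no `def … : Prop`, no hypothesis-fact); standard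
axioms; imports BY NAME, restating nothing.

HONEST SCOPE / DIVERGENCES. (1) Lattice units of p21's torus (fine spacing `1`, `len(y) = L^j`), V1 fine factor `c` explicit (`G′ ∝ c⁻²`, legs `∝ |c|⁻¹`,
`S ∝ c⁴`; print's `η`-normalisation is the consumer's, as in gen 19). (2) The weights of `Δ′_a`, `G′`, `S` are p21's printed level weights `a_j =
aPrinted ℓ 1 j`; `P = G′SG′` does not depend on them (`R` is the orthogonal projection onto `ΔN(Q′)`), so the five-factor form with THESE weights
serves Sect. A's `R` of every weight. (3) `S` is ONE site operator (p38's sandwich form); `Q′`, `Q′*`, `(Q′G′²Q′*)⁻¹` are not charted separately.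
(4) The member `P_□`: apply §3–§5 to the member family `B6MemberTorusTDomainsV1.famOf …` (member `hN_□`, big-block parameter `M_h/L` per the fold
owner's alignment 04:42Z) and `tsV1_P_chart` there; the window transplant/conjugation and the MIXED ring data (`χ·Δ′_a·G̃′_□ = χ`, hS1/hS2 across the
window) are NOT here (FILE 3). (5) The zone kernels `[χ, Δ′_a]G′` of the domain-change algebra are not here. (6) Constants existential (`d, L` only),
not optimised; nothing on d = 4 or the continuum; NOT summit progress.  Unit `lit-balaban-p22` (gen 20), 2026-08-23.
-/

noncomputable section

open scoped Matrix BigOperators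
open Finset

namespace Literature.MathematicalPhysics.QuantumFieldTheory.Balaban1983to89.B6ScalarFactorsChartV1

open B4Reflection242 (boxDom mem_boxDom blk)
open B6MultiLevelBoxOperator (N0 aPrinted)
open B6MultiLevelTorusOperator (TDomains tshift unitVec shiftMat shiftMat_mulVec shiftMat_neg)
open B6Geom246MultiLevelBox (bset blkOf)
open B6Geom246MultiLevelTorus (geomT)
open B8Ineq192MultiLevelTorus (geomTB)
open B6Ineq268MultiLevelBox (W W_pos W_eq card_blkOf_le)
open B6RandomWalk (HasMajorant BlockSupp hasMajorant_mono)
open B6RandomWalkHom (HasMajorantHom)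
open B6Ineq2133TwoScaleV1 (onFun onFun_apply)
open B6SectAOperatorsV1 (ScalarSpace dE dsE RE dE_apply dsE_apply)
open B6GlobalChartV1 (PV toBox toBox_apply toBox_injective boxEquiv boxEquiv_apply blkV1 domT)
open B6ScalarChartV1 (toBox_shift toBox_unshift boxEquiv_symm_toBox toBox_boxEquiv_symm)
open B6Dg288ChartV1 (RE_eq_rM_chart)
open B6Ineq288MultiLevelTorus (GT dP QsM QM GiM pM rM one_sub_rM G_mul_dP dP_mul_G GiM_mul)
open B6Prop22DerivMultiLevelTorus (dT dT_mulVec)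
open BalabanImbrieJaffe1984to88.BIJ85AxialPropagator411 (BondSpace)

variable {d ℓ : ℕ} {m K : ℕ} {hd : 1 ≤ d + 1} {hL : Odd (ℓ + 1) ∧ 1 < ℓ + 1}
variable {Mh k R : ℕ} {P' : Fin (d + 1) → ℕ}

/-! ## §1  p21's torus matrices as operators on the V1 scalar site functions: the chart transport -/

section ChartOp

variable (hN : ∀ μ, N0 ℓ Mh k P' μ = (PV d ℓ m K hd hL).sitesPerDir 0)

/-- **A TORUS MATRIX READ ON THE V1 SITE FUNCTIONS THROUGH THE CHART**: `(M̂f)(x) = (M·(f∘chart⁻¹))(toBox x)`.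
[cite: Balaban1984PropagatorsII, (2.1) p.224 («Ω_j ⊂ T_η»), (2.17) p.225, dictionary] -/
def chartOp (M : Matrix ↥(boxDom (N0 ℓ Mh k P')) ↥(boxDom (N0 ℓ Mh k P')) ℝ) : Module.End ℝ (Site (PV d ℓ m K hd hL) 0 → ℝ) where
  toFun f x := (M *ᵥ fun z => f ((boxEquiv hN).symm z)) (toBox hN x)
  map_add' f g := by
    funext x
    have e : (fun z => (f + g) ((boxEquiv hN).symm z)) = (fun z => f ((boxEquiv hN).symm z)) + fun z => g ((boxEquiv hN).symm z) := rfl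
    rw [e, Matrix.mulVec_add]; rfl
  map_smul' r f := by
    funext x
    have e : (fun z => (r • f) ((boxEquiv hN).symm z)) = r • fun z => f ((boxEquiv hN).symm z) := rfl
    rw [e, Matrix.mulVec_smul]; rfl

/-- the defining formula. [cite: Balaban1984PropagatorsII, (2.1) p.224, dictionary] -/
@[simp] theorem chartOp_apply (M : Matrix ↥(boxDom (N0 ℓ Mh k P')) ↥(boxDom (N0 ℓ Mh k P')) ℝ) (f : Site (PV d ℓ m K hd hL) 0 → ℝ)
    (x : Site (PV d ℓ m K hd hL) 0) : chartOp hN M f x = (M *ᵥ fun z => f ((boxEquiv hN).symm z)) (toBox hN x) := rfl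

/-- reading back: `(M̂f)∘chart⁻¹ = M·(f∘chart⁻¹)`. [cite: Balaban1984PropagatorsII, (2.1) p.224, dictionary] -/
theorem chartOp_comp_symm (M : Matrix ↥(boxDom (N0 ℓ Mh k P')) ↥(boxDom (N0 ℓ Mh k P')) ℝ) (f : Site (PV d ℓ m K hd hL) 0 → ℝ) :
    (fun z => chartOp hN M f ((boxEquiv hN).symm z)) = M *ᵥ fun z => f ((boxEquiv hN).symm z) := by
  funext z
  rw [chartOp_apply, toBox_boxEquiv_symm]

/-- the transport is multiplicative. [cite: Balaban1984PropagatorsII, (2.1) p.224, dictionary] -/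
theorem chartOp_mul (M M' : Matrix ↥(boxDom (N0 ℓ Mh k P')) ↥(boxDom (N0 ℓ Mh k P')) ℝ) :
    chartOp hN (M * M') = chartOp hN M * chartOp hN M' := by
  apply LinearMap.ext; intro f; funext x
  rw [Module.End.mul_apply, chartOp_apply, chartOp_apply, chartOp_comp_symm, Matrix.mulVec_mulVec]

/-- the transport is unital. [cite: Balaban1984PropagatorsII, (2.1) p.224, dictionary] -/
theorem chartOp_one : chartOp hN (1 : Matrix ↥(boxDom (N0 ℓ Mh k P')) ↥(boxDom (N0 ℓ Mh k P')) ℝ) = 1 := by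
  apply LinearMap.ext; intro f; funext x
  rw [chartOp_apply, Matrix.one_mulVec, boxEquiv_symm_toBox]; rfl

/-- the transport is additive. [cite: Balaban1984PropagatorsII, (2.1) p.224, dictionary] -/
theorem chartOp_add (M M' : Matrix ↥(boxDom (N0 ℓ Mh k P')) ↥(boxDom (N0 ℓ Mh k P')) ℝ) :
    chartOp hN (M + M') = chartOp hN M + chartOp hN M' := by
  apply LinearMap.ext; intro f; funext x
  rw [chartOp_apply, Matrix.add_mulVec]; rfl

/-- the transport is homogeneous. [cite: Balaban1984PropagatorsII, (2.1) p.224, dictionary] -/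
theorem chartOp_smul (r : ℝ) (M : Matrix ↥(boxDom (N0 ℓ Mh k P')) ↥(boxDom (N0 ℓ Mh k P')) ℝ) :
    chartOp hN (r • M) = r • chartOp hN M := by
  apply LinearMap.ext; intro f; funext x
  rw [chartOp_apply, Matrix.smul_mulVec]; rfl

/-- the transport of a difference. [cite: Balaban1984PropagatorsII, (2.1) p.224, dictionary] -/
theorem chartOp_sub (M M' : Matrix ↥(boxDom (N0 ℓ Mh k P')) ↥(boxDom (N0 ℓ Mh k P')) ℝ) :
    chartOp hN (M - M') = chartOp hN M - chartOp hN M' := by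
  apply LinearMap.ext; intro f; funext x
  rw [chartOp_apply, Matrix.sub_mulVec]; rfl

/-- an `ℓ²`-operator whose values are those of a torus matrix through the chart IS the transported matrix (as an operator on functions).
[cite: Balaban1984PropagatorsII, (2.17) p.225, dictionary] -/
theorem onFun_eq_chartOp {T : ScalarSpace (PV d ℓ m K hd hL) →ₗ[ℝ] ScalarSpace (PV d ℓ m K hd hL)}
    {M : Matrix ↥(boxDom (N0 ℓ Mh k P')) ↥(boxDom (N0 ℓ Mh k P')) ℝ}
    (h : ∀ (f : ScalarSpace (PV d ℓ m K hd hL)) (x : Site (PV d ℓ m K hd hL) 0), T f x = (M *ᵥ fun z => f ((boxEquiv hN).symm z)) (toBox hN x)) :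
    onFun T = chartOp hN M := by
  apply LinearMap.ext; intro f; funext x
  rw [onFun_apply, chartOp_apply, h]

end ChartOp

/-! ## §2  Block majorants are transported along the chart (sites, and the two legs sites ↔ bonds) -/

section Transfer

variable (hN : ∀ μ, N0 ℓ Mh k P' μ = (PV d ℓ m K hd hL).sitesPerDir 0) (D : TDomains d ℓ Mh k P' R)

/-- **THE BLOCK MAP OF THE V1 SITES** in p21's `𝔅`: `x ↦ y(x)`, the block of the torus family containing the chart point of `x`.
[cite: Balaban1984PropagatorsII, (2.45)–(2.46) p.231 («d(x, x′) = d(y, y′) if x ∈ B^j(y)»), dictionary] -/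
abbrev blkS (x : Site (PV d ℓ m K hd hL) 0) : ↥(bset D.toDomains) := blkOf D.toDomains (toBox hN x)

/-- the bond block map of ROUTE V is the site block map of the initial point. [cite: Balaban1984PropagatorsII, (2.45) p.231, dictionary] -/
theorem blkV1_eq_blkS (b : PBond (PV d ℓ m K hd hL) 0) : blkV1 hN D b = blkS hN D b.src := rfl

/-- a block-supported V1 site function read on the box is block-supported. [folklore] -/
private theorem blockSupp_symm {μ : Site (PV d ℓ m K hd hL) 0 → ℝ} {y' : ↥(bset D.toDomains)} {B : ℝ}
    (hμ : BlockSupp (g := geomT D) (blkS hN D) μ y' B) :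
    BlockSupp (g := geomT D) (blkOf D.toDomains) (fun z => μ ((boxEquiv hN).symm z)) y' B := by
  refine ⟨hμ.nonneg, fun z hz => hμ.bound _ ?_, fun z hz => hμ.off _ ?_⟩
  · unfold blkS; rw [toBox_boxEquiv_symm]; exact hz
  · unfold blkS; rw [toBox_boxEquiv_symm]; exact hz

/-- **SITE MAJORANTS TRANSPORT**: a (2.51)-shape majorant of the torus matrix `M` (block map `blkOf`) is a majorant of `M̂` on the V1 sites
(block map `blkS`). [cite: Balaban1984PropagatorsII, (2.51) p.232, (2.64)–(2.66) p.234, dictionary] -/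
theorem hasMajorant_chartOp {M : Matrix ↥(boxDom (N0 ℓ Mh k P')) ↥(boxDom (N0 ℓ Mh k P')) ℝ} {Kf : ↥(bset D.toDomains) → ↥(bset D.toDomains) → ℝ}
    (h : HasMajorant (g := geomT D) (blkOf D.toDomains) (Matrix.toLin' M) Kf) :
    HasMajorant (g := geomT D) (blkS hN D) (chartOp hN M) Kf := by
  intro y' μ B hμ x
  have h1 := h y' _ B (blockSupp_symm hN D hμ) (toBox hN x)
  rw [Matrix.toLin'_apply] at h1
  rw [chartOp_apply]
  exact h1

/-- **THE LEFT LEG `∂M̂` (sites → bonds)**: `(∂_c(M̂f))(⟨x, μ⟩) = c·((∂_μM)(f∘chart⁻¹))(toBox x)`, `∂_μ = S_{e_μ} − 1` p21's periodic forward difference.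
[cite: Balaban1984PropagatorsII, (2.67) p.234 (entry ∇G′), (2.7) p.224, dictionary] -/
theorem dE_chartOp_apply (c : ℝ) (M : Matrix ↥(boxDom (N0 ℓ Mh k P')) ↥(boxDom (N0 ℓ Mh k P')) ℝ) (f : Site (PV d ℓ m K hd hL) 0 → ℝ)
    (b : PBond (PV d ℓ m K hd hL) 0) :
    (onFun (dE c) ∘ₗ chartOp hN M) f b = c * ((dT (N0 ℓ Mh k P') b.dir * M) *ᵥ fun z => f ((boxEquiv hN).symm z)) (toBox hN b.src) := by
  rw [LinearMap.comp_apply, onFun_apply, dE_apply, WithLp.ofLp_toLp]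
  unfold LatticeFieldCalculus.grad
  rw [show b.tgt = b.src.shift b.dir from rfl, smul_eq_mul, chartOp_apply, chartOp_apply, ← Matrix.mulVec_mulVec, dT_mulVec,
    toBox_shift hN b.src b.dir]

/-- **LEFT-LEG MAJORANTS TRANSPORT**: majorants of the torus matrices `∂_μM`, `μ = 1 … d+1`, give a two-space majorant of `∂_c ∘ M̂`
(V1 sites → V1 bonds, block maps `blkS`, `blkV1`), constant `|c|`. [cite: Balaban1984PropagatorsII, (2.67) p.234 (entry ∇G′), (2.51) p.232, dictionary] -/
theorem hasMajorantHom_dE_chartOp (c : ℝ) {M : Matrix ↥(boxDom (N0 ℓ Mh k P')) ↥(boxDom (N0 ℓ Mh k P')) ℝ}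
    {Kf : ↥(bset D.toDomains) → ↥(bset D.toDomains) → ℝ}
    (h : ∀ μ, HasMajorant (g := geomT D) (blkOf D.toDomains) (Matrix.toLin' (dT (N0 ℓ Mh k P') μ * M)) Kf) :
    HasMajorantHom (g := geomT D) (blkS hN D) (blkV1 hN D) (onFun (dE c) ∘ₗ chartOp hN M) (fun y y' => |c| * Kf y y') := by
  intro y' μ B hμ b
  have h1 := h b.dir y' _ B (blockSupp_symm hN D hμ) (toBox hN b.src)
  rw [Matrix.toLin'_apply] at h1
  rw [dE_chartOp_apply, abs_mul, mul_assoc]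
  exact mul_le_mul_of_nonneg_left h1 (abs_nonneg c)

/-- the `ν`-component of a V1 bond function, read on the box. [cite: Balaban1984PropagatorsII, (2.8) p.224, dictionary] -/
def comp (A : PBond (PV d ℓ m K hd hL) 0 → ℝ) (ν : Fin (d + 1)) : ↥(boxDom (N0 ℓ Mh k P')) → ℝ :=
  fun z => A ⟨(boxEquiv hN).symm z, ν⟩

/-- **THE RIGHT LEG `M̂∂*` (bonds → sites)**: `(M̂(∂_c*A))(x) = c·Σ_ν ((M·∂_νᵀ)A_ν)(toBox x)` with `A_ν = A(·, ν)∘chart⁻¹`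
(`∂_νᵀ = S_{−e_ν} − 1`: the divergence is minus the backward difference). [cite: Balaban1984PropagatorsII, (2.67) p.234 (entry G′∇*), (2.8) p.224, dictionary] -/
theorem chartOp_dsE_apply (c : ℝ) (M : Matrix ↥(boxDom (N0 ℓ Mh k P')) ↥(boxDom (N0 ℓ Mh k P')) ℝ) (A : PBond (PV d ℓ m K hd hL) 0 → ℝ)
    (x : Site (PV d ℓ m K hd hL) 0) :
    (chartOp hN M ∘ₗ onFun (dsE c)) A x = c * ∑ ν : Fin (d + 1), ((M * (dT (N0 ℓ Mh k P') ν)ᵀ) *ᵥ comp hN A ν) (toBox hN x) := by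
  classical
  rw [LinearMap.comp_apply, chartOp_apply]
  -- the divergence read on the box, componentwise
  have hdiv : (fun z => onFun (dsE c) A ((boxEquiv hN).symm z)) =
      fun z => c * ∑ ν : Fin (d + 1), ((dT (N0 ℓ Mh k P') ν)ᵀ *ᵥ comp hN A ν) z := by
    funext z
    rw [onFun_apply, dsE_apply, WithLp.ofLp_toLp]
    unfold LatticeFieldCalculus.diverg
    rw [Finset.mul_sum]
    refine Finset.sum_congr rfl fun ν _ => ?_
    unfold dT
    rw [Matrix.transpose_sub, Matrix.transpose_one, ← shiftMat_neg, Matrix.sub_mulVec, Pi.sub_apply, shiftMat_mulVec,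
      Matrix.one_mulVec]
    unfold comp
    rw [← toBox_boxEquiv_symm hN z, ← toBox_unshift hN, boxEquiv_symm_toBox, boxEquiv_symm_toBox, smul_eq_mul]
  rw [hdiv]
  have e : (fun z => c * ∑ ν : Fin (d + 1), ((dT (N0 ℓ Mh k P') ν)ᵀ *ᵥ comp hN A ν) z) =
      c • ∑ ν : Fin (d + 1), (dT (N0 ℓ Mh k P') ν)ᵀ *ᵥ comp hN A ν := by
    funext z; simp [Finset.sum_apply]
  rw [e, Matrix.mulVec_smul, Matrix.mulVec_sum, Pi.smul_apply, smul_eq_mul, Finset.sum_apply]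
  refine congrArg (c * ·) (Finset.sum_congr rfl fun ν _ => ?_)
  rw [Matrix.mulVec_mulVec]

/-- **RIGHT-LEG MAJORANTS TRANSPORT**: majorants of the torus matrices `M·∂_νᵀ`, `ν = 1 … d+1`, give a two-space majorant of `M̂ ∘ ∂_c*`
(V1 bonds → V1 sites), constant `(d+1)|c|`. [cite: Balaban1984PropagatorsII, (2.67) p.234 (entry G′∇*), (2.51) p.232, dictionary] -/
theorem hasMajorantHom_chartOp_dsE (c : ℝ) {M : Matrix ↥(boxDom (N0 ℓ Mh k P')) ↥(boxDom (N0 ℓ Mh k P')) ℝ}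
    {Kf : ↥(bset D.toDomains) → ↥(bset D.toDomains) → ℝ}
    (h : ∀ ν, HasMajorant (g := geomT D) (blkOf D.toDomains) (Matrix.toLin' (M * (dT (N0 ℓ Mh k P') ν)ᵀ)) Kf) :
    HasMajorantHom (g := geomT D) (blkV1 hN D) (blkS hN D) (chartOp hN M ∘ₗ onFun (dsE c)) (fun y y' => ((d : ℝ) + 1) * |c| * Kf y y') := by
  classical
  intro y' A B hA x
  have hcomp : ∀ ν, BlockSupp (g := geomT D) (blkOf D.toDomains) (comp hN A ν) y' B := fun ν =>
    ⟨hA.nonneg, fun z hz => hA.bound ⟨(boxEquiv hN).symm z, ν⟩ (by rw [blkV1_eq_blkS]; unfold blkS; rw [toBox_boxEquiv_symm]; exact hz),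
      fun z hz => hA.off ⟨(boxEquiv hN).symm z, ν⟩ (by rw [blkV1_eq_blkS]; unfold blkS; rw [toBox_boxEquiv_symm]; exact hz)⟩
  have h1 : ∀ ν, |((M * (dT (N0 ℓ Mh k P') ν)ᵀ) *ᵥ comp hN A ν) (toBox hN x)| ≤ Kf (blkS hN D x) y' * B := fun ν => by
    have := h ν y' _ B (hcomp ν) (toBox hN x)
    rwa [Matrix.toLin'_apply] at this
  rw [chartOp_dsE_apply, abs_mul]
  calc |c| * |∑ ν : Fin (d + 1), ((M * (dT (N0 ℓ Mh k P') ν)ᵀ) *ᵥ comp hN A ν) (toBox hN x)|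
      ≤ |c| * ∑ ν : Fin (d + 1), |((M * (dT (N0 ℓ Mh k P') ν)ᵀ) *ᵥ comp hN A ν) (toBox hN x)| :=
        mul_le_mul_of_nonneg_left (Finset.abs_sum_le_sum_abs _ _) (abs_nonneg c)
    _ ≤ |c| * ∑ _ν : Fin (d + 1), Kf (blkS hN D x) y' * B := mul_le_mul_of_nonneg_left (Finset.sum_le_sum fun ν _ => h1 ν) (abs_nonneg c)
    _ = ((d : ℝ) + 1) * |c| * Kf (blkS hN D x) y' * B := by
        rw [Finset.sum_const, Finset.card_univ, Fintype.card_fin, nsmul_eq_mul]; push_cast; ring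

end Transfer


/-! ## §3  The scalar factors of (2.17) on the V1 site functions: `Δ′_a`, `G′`, `S := Q′*(Q′G′²Q′*)⁻¹Q′`, and `P = G′SG′` -/

section Factors

variable (hN : ∀ μ, N0 ℓ Mh k P' μ = (PV d ℓ m K hd hL).sitesPerDir 0) (D : TDomains d ℓ Mh k P' R) (hk : k ≤ m + K)

/-- **`Δ′_a = Δ + Q′*aQ′` OF (2.13) ON THE V1 SITE FUNCTIONS** (fine factor `c`, printed level weights `a_j`): `c²` times p21's torus
matrix `mlOpT` through the chart. [cite: Balaban1984PropagatorsII, (2.13)–(2.14) p.225] -/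
def DpV (c : ℝ) : Module.End ℝ (Site (PV d ℓ m K hd hL) 0 → ℝ) := c ^ 2 • chartOp hN (dP D)

/-- **`G′ = Δ′_a⁻¹` OF (2.17) ON THE V1 SITE FUNCTIONS**: `c⁻²` times p21's torus Green's matrix `gmlT` through the chart.
[cite: Balaban1984PropagatorsII, (2.17) p.225 («G′ = Δ′_a⁻¹ is a well defined, positive operator»)] -/
def GpV (c : ℝ) : Module.End ℝ (Site (PV d ℓ m K hd hL) 0 → ℝ) := (c ^ 2)⁻¹ • chartOp hN (GT D)

/-- **`S := Q′*(Q′G′²Q′*)⁻¹Q′` — THE MIDDLE FACTOR OF `P = G′Q′*(Q′G′²Q′*)⁻¹Q′G′` AS ONE SITE OPERATOR**: `c⁴` times p21's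
`QsM·GiM·QM` through the chart. [cite: Balaban1984PropagatorsII, (2.17) p.225, Prop. 2.3 (2.86) p.238] -/
def SV (c : ℝ) : Module.End ℝ (Site (PV d ℓ m K hd hL) 0 → ℝ) := c ^ 4 • chartOp hN (QsM D * GiM D * QM D)

/-- `G′Δ′_a = 1`. [cite: Balaban1984PropagatorsII, p.225 («G′ = Δ′_a^{−1}»)] -/
theorem GpV_mul_DpV (hℓ : 1 ≤ ℓ) (hMh : 1 ≤ Mh) (hP : ∀ μ, 1 ≤ P' μ) {c : ℝ} (hc : c ≠ 0) : GpV hN D c * DpV hN D c = 1 := by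
  unfold GpV DpV
  rw [smul_mul_smul_comm, ← chartOp_mul, G_mul_dP D hℓ hMh hP, chartOp_one, inv_mul_cancel₀ (pow_ne_zero 2 hc), one_smul]

/-- `Δ′_aG′ = 1`. [cite: Balaban1984PropagatorsII, p.225 («G′ = Δ′_a^{−1}»)] -/
theorem DpV_mul_GpV (hℓ : 1 ≤ ℓ) (hMh : 1 ≤ Mh) (hP : ∀ μ, 1 ≤ P' μ) {c : ℝ} (hc : c ≠ 0) : DpV hN D c * GpV hN D c = 1 := by
  unfold GpV DpV
  rw [smul_mul_smul_comm, ← chartOp_mul, dP_mul_G D hℓ hMh hP, chartOp_one, mul_inv_cancel₀ (pow_ne_zero 2 hc), one_smul]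

include hk in
/-- **`P = I − R = G′SG′` ON THE V1 SITE FUNCTIONS** — Sect. A's orthogonal projection `R = RE (domT hN D hk) c` onto `ΔN(Q′)`, complemented,
IS the five-factor operator (2.17) built from the charted factors (gen 19's `RE_eq_rM_chart` + p21's `pM = G′Q′*(Q′G′²Q′*)⁻¹Q′G′`).
[cite: Balaban1984PropagatorsII, (2.17) p.225 («Rf = … (I − G′Q′*(Q′G′²Q′*)⁻¹Q′G′)f»)] -/
theorem onFun_oneSubRE_eq (hℓ : 1 ≤ ℓ) (hMh : 1 ≤ Mh) (hP : ∀ μ, 1 ≤ P' μ) {c : ℝ} (hc : c ≠ 0) :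
    onFun (LinearMap.id - RE (domT hN D hk) c) = GpV hN D c * SV hN D c * GpV hN D c := by
  have h1 : onFun (LinearMap.id - RE (domT hN D hk) c) = chartOp hN (pM D) := by
    refine onFun_eq_chartOp hN fun f x => ?_
    rw [← one_sub_rM, Matrix.sub_mulVec, Matrix.one_mulVec, Pi.sub_apply, LinearMap.sub_apply, LinearMap.id_apply, PiLp.sub_apply,
      RE_eq_rM_chart hN D hk hℓ hMh hP hc f x, boxEquiv_symm_toBox]
  rw [h1]
  unfold GpV SV
  rw [smul_mul_smul_comm, smul_mul_smul_comm, ← chartOp_mul, ← chartOp_mul]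
  have hc2 : c ^ 2 ≠ 0 := pow_ne_zero 2 hc
  have e : (c ^ 2)⁻¹ * c ^ 4 * (c ^ 2)⁻¹ = 1 := by field_simp
  rw [e, one_smul]
  unfold pM
  simp only [Matrix.mul_assoc]

/-- **`S·G′²·S = S`** (`(Q′G′²Q′*)⁻¹·(Q′G′²Q′*) = 1`, p21's `GiM_mul`) — the inverse identity the domain-change algebra consumes (hS1 on one carrier).
[cite: Balaban1984PropagatorsII, (2.17) p.225, Prop. 2.3 p.238 («an inverse of the operator Q′G′²Q′*»)] -/
theorem SV_mul_GpV_sq_mul_SV (hℓ : 1 ≤ ℓ) (hMh : 1 ≤ Mh) (hP : ∀ μ, 1 ≤ P' μ) {c : ℝ} (hc : c ≠ 0) :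
    SV hN D c * (GpV hN D c * GpV hN D c) * SV hN D c = SV hN D c := by
  unfold GpV SV
  rw [smul_mul_smul_comm, smul_mul_smul_comm, smul_mul_smul_comm, ← chartOp_mul, ← chartOp_mul, ← chartOp_mul]
  have hc2 : c ^ 2 ≠ 0 := pow_ne_zero 2 hc
  have e : c ^ 4 * ((c ^ 2)⁻¹ * (c ^ 2)⁻¹) * c ^ 4 = c ^ 4 := by field_simp
  rw [e]
  have hX := (GiM_mul D hℓ hMh hP).2
  have key : QsM D * GiM D * QM D * (GT D * GT D) * (QsM D * GiM D * QM D) = QsM D * GiM D * QM D :=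
    calc QsM D * GiM D * QM D * (GT D * GT D) * (QsM D * GiM D * QM D)
        = QsM D * GiM D * ((QM D * GT D * GT D * QsM D) * GiM D) * QM D := by simp only [Matrix.mul_assoc]
      _ = QsM D * GiM D * QM D := by rw [hX, Matrix.mul_one]
  rw [key]

/-- `G′S·G′²·S = G′S` (hS2 on one carrier). [cite: Balaban1984PropagatorsII, (2.17) p.225, Prop. 2.3 p.238] -/
theorem GpV_SV_mul_GpV_sq_mul_SV (hℓ : 1 ≤ ℓ) (hMh : 1 ≤ Mh) (hP : ∀ μ, 1 ≤ P' μ) {c : ℝ} (hc : c ≠ 0) :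
    GpV hN D c * SV hN D c * (GpV hN D c * GpV hN D c) * SV hN D c = GpV hN D c * SV hN D c := by
  rw [mul_assoc (GpV hN D c) (SV hN D c), mul_assoc (GpV hN D c), SV_mul_GpV_sq_mul_SV hN D hℓ hMh hP hc]

/-- `P² = P` for the five-factor operator. [cite: Balaban1984PropagatorsII, (2.17) p.225 («R an orthogonal projection»)] -/
theorem GSG_idem (hℓ : 1 ≤ ℓ) (hMh : 1 ≤ Mh) (hP : ∀ μ, 1 ≤ P' μ) {c : ℝ} (hc : c ≠ 0) :
    (GpV hN D c * SV hN D c * GpV hN D c) * (GpV hN D c * SV hN D c * GpV hN D c) = GpV hN D c * SV hN D c * GpV hN D c := by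
  calc (GpV hN D c * SV hN D c * GpV hN D c) * (GpV hN D c * SV hN D c * GpV hN D c)
      = (GpV hN D c * SV hN D c * (GpV hN D c * GpV hN D c) * SV hN D c) * GpV hN D c := by simp only [mul_assoc]
    _ = GpV hN D c * SV hN D c * GpV hN D c := by rw [GpV_SV_mul_GpV_sq_mul_SV hN D hℓ hMh hP hc]

/-- the entries of the middle factor: `(Q′*CQ′)(x, x′) = C̃(y(x), y(x′))/W(y(x′))` with `C̃ = mat GinvT`.
[cite: Balaban1984PropagatorsII, (2.69) p.235, (2.86) p.238, dictionary] -/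
theorem S_entry (x x' : ↥(boxDom (N0 ℓ Mh k P'))) :
    (QsM D * GiM D * QM D) x x' = GiM D (blkOf D.toDomains x) (blkOf D.toDomains x') * (W D.toDomains (blkOf D.toDomains x'))⁻¹ := by
  classical
  rw [Matrix.mul_apply]
  have h1 : ∀ y₂, (QsM D * GiM D) x y₂ = GiM D (blkOf D.toDomains x) y₂ := fun y₂ => by
    rw [Matrix.mul_apply]
    simp only [QsM, ite_mul, one_mul, zero_mul, Finset.sum_ite_eq, Finset.mem_univ, if_true]
  simp only [h1, QM, mul_ite, mul_zero]
  rw [Finset.sum_ite_eq, if_pos (Finset.mem_univ _)]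

end Factors

/-! ## §4  (2.67)₁₂₃ and (2.87) on the torus at the printed weights, one threshold (p21's theorems BY NAME) -/

section Printed

open B6Geom246MultiLevelTorus (triangle_refl_nonneg_T)

/-- **PROPOSITION 2.2 (2.67), ENTRIES 1–3, FOR THE GENUINE `k`-LEVEL `G′` OF THE TORUS AT THE PRINTED WEIGHTS, ONE THRESHOLD** (p21's
`prop22_first/second/third_multiLevelTorus` at `a_j = aPrinted ℓ 1 j`, `c_j = 1`, with the weight windows of `KIdx.aPrinted_windows`; common rate
`δ`, common constant `C`, threshold `M₁ ≤ L·M_h` absorbing `M_h ≥ 3`, (2.59) and «M sufficiently large»): for every torus family `D`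
with `P_μ ≥ 4`, `R ≥ 2L`: `G′`, `∂_μG′`, `G′∂_μᵀ` have the block majorants `C·L^{2j}e^{−δd}`, `C·L^{j}e^{−δd}`, `C·L^{j}e^{−δd}` on `geomT D`.
[cite: Balaban1984PropagatorsII, Proposition 2.2 (2.67) p.234 (entries 1–3), (2.64)–(2.66) p.234] -/
theorem prop22_entries_printed (d ℓ : ℕ) (hℓ : 1 ≤ ℓ) :
    ∃ M₁ δ C : ℝ, 0 < M₁ ∧ 0 < δ ∧ 0 < C ∧
      ∀ (k Mh R : ℕ), M₁ ≤ ((ℓ : ℝ) + 1) * Mh → 2 * (ℓ + 1) ≤ R →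
      ∀ (P : Fin (d + 1) → ℕ) (_hP4 : ∀ μ, 4 ≤ P μ) (D : TDomains d ℓ Mh k P R),
        HasMajorant (g := geomT D) (blkOf D.toDomains) (Matrix.toLin' (GT D))
          (fun y y' => C * ((ℓ : ℝ) + 1) ^ (2 * y.1.1) * Real.exp (-(δ * (geomT D).dist y y'))) ∧
        (∀ μ, HasMajorant (g := geomT D) (blkOf D.toDomains) (Matrix.toLin' (dT (N0 ℓ Mh k P) μ * GT D))
          (fun y y' => C * ((ℓ : ℝ) + 1) ^ y.1.1 * Real.exp (-(δ * (geomT D).dist y y')))) ∧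
        (∀ μ, HasMajorant (g := geomT D) (blkOf D.toDomains) (Matrix.toLin' (GT D * (dT (N0 ℓ Mh k P) μ)ᵀ))
          (fun y y' => C * ((ℓ : ℝ) + 1) ^ y.1.1 * Real.exp (-(δ * (geomT D).dist y y')))) := by
  set amin : ℝ := 1 - ((((ℓ : ℝ) + 1)) ^ 2)⁻¹ with hamin_def
  have hL2 : (1 : ℝ) < (((ℓ : ℝ) + 1)) ^ 2 := by
    have : (2 : ℝ) ≤ (ℓ : ℝ) + 1 := by
      have : (1 : ℝ) ≤ ℓ := by exact_mod_cast hℓ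
      linarith
    nlinarith
  have hamin : 0 < amin := by rw [hamin_def, sub_pos]; exact inv_lt_one_of_one_lt₀ hL2
  obtain ⟨hwin, hrec⟩ := B6Prop22KLevelCensus.KIdx.aPrinted_windows hℓ
  obtain ⟨δ₁, C₁, M₁', N₁, hδ₁, hC₁, hM₁', hN₁, hA1⟩ :=
    B6Prop22MultiLevelTorus.prop22_first_multiLevelTorus d ℓ hℓ amin 1 1 1 hamin one_pos
  obtain ⟨δ₂, C₂, M₂', N₂, hδ₂, hC₂, hM₂', hN₂, hA2⟩ :=
    B6Prop22DerivMultiLevelTorus.prop22_second_multiLevelTorus d ℓ hℓ amin 1 1 1 hamin one_pos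
  obtain ⟨δ₃, C₃, M₃', N₃, hδ₃, hC₃, hM₃', hN₃, hA3⟩ :=
    B6Prop22AdjMultiLevelTorus.prop22_third_multiLevelTorus d ℓ hℓ amin 1 1 1 hamin one_pos
  set δ : ℝ := min δ₁ (min δ₂ δ₃) / 2 with hδ
  set C : ℝ := C₁ + C₂ + C₃ with hC
  set Nm : ℕ := max N₁ (max N₂ N₃) with hNm
  set M₁ : ℝ := max (max (max M₁' (max M₂' M₃')) ((Nm : ℝ) + 1)) (3 * ((ℓ : ℝ) + 1)) with hM₁
  have hδpos : 0 < δ := by rw [hδ]; exact div_pos (lt_min hδ₁ (lt_min hδ₂ hδ₃)) two_pos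
  refine ⟨M₁, δ, C, lt_of_lt_of_le hM₁' (le_trans (le_trans (le_max_left _ _) (le_max_left _ _)) (le_max_left _ _)), hδpos,
    by positivity, ?_⟩
  intro k Mh R hM hR P hP4 D
  have hP : ∀ μ, 1 ≤ P μ := fun μ => le_trans (by norm_num) (hP4 μ)
  have hL : (0 : ℝ) < (ℓ : ℝ) + 1 := by positivity
  have hMh3 : 3 ≤ Mh := by
    have h3 : 3 * ((ℓ : ℝ) + 1) ≤ ((ℓ : ℝ) + 1) * Mh := le_trans (le_max_right _ _) hM
    have : (3 : ℝ) ≤ Mh := by nlinarith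
    exact_mod_cast this
  have hMh1 : 1 ≤ Mh := le_trans (by norm_num) hMh3
  have hMa : max M₁' (max M₂' M₃') ≤ ((ℓ : ℝ) + 1) * Mh := le_trans (le_trans (le_max_left _ _) (le_max_left _ _)) hM
  have hM1a : M₁' ≤ ((ℓ : ℝ) + 1) * Mh := le_trans (le_max_left _ _) hMa
  have hM2a : M₂' ≤ ((ℓ : ℝ) + 1) * Mh := le_trans (le_trans (le_max_left _ _) (le_max_right _ _)) hMa
  have hM3a : M₃' ≤ ((ℓ : ℝ) + 1) * Mh := le_trans (le_trans (le_max_right _ _) (le_max_right _ _)) hMa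
  have hRM : ∀ N : ℕ, N ≤ Nm → N + 1 ≤ R * ((ℓ + 1) * Mh) := by
    intro N hN'
    have h1 : ((Nm : ℝ) + 1) ≤ ((ℓ : ℝ) + 1) * Mh := le_trans (le_trans (le_max_right _ _) (le_max_left _ _)) hM
    have h2 : Nm + 1 ≤ (ℓ + 1) * Mh := by exact_mod_cast h1
    have hR1 : 1 ≤ R := le_trans (by omega) hR
    calc N + 1 ≤ 1 * ((ℓ + 1) * Mh) := by rw [one_mul]; omega
      _ ≤ R * ((ℓ + 1) * Mh) := Nat.mul_le_mul_right _ hR1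
  have hN1m : N₁ ≤ Nm := le_max_left _ _
  have hN2m : N₂ ≤ Nm := le_trans (le_max_left _ _) (le_max_right _ _)
  have hN3m : N₃ ≤ Nm := le_trans (le_max_right _ _) (le_max_right _ _)
  have hdnn : ∀ y y' : ↥(bset D.toDomains), 0 ≤ (geomT D).dist y y' := (triangle_refl_nonneg_T D hMh1 hP).2.2
  -- comparison of the three packages' kernels with the common one
  have hrate : ∀ (δ' : ℝ), min δ₁ (min δ₂ δ₃) ≤ δ' → ∀ y y' : ↥(bset D.toDomains),
      Real.exp (-(δ' / 2 * (geomT D).dist y y')) ≤ Real.exp (-(δ * (geomT D).dist y y')) := by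
    intro δ' hδ' y y'
    rw [Real.exp_le_exp, hδ, neg_le_neg_iff]
    exact mul_le_mul_of_nonneg_right (by linarith) (hdnn y y')
  have hw := fun i (hi : 1 ≤ i) => hwin i hi
  have hcw : ∀ i, 1 ≤ i → (1 : ℝ) ≤ (fun _ : ℕ => (1 : ℝ)) i ∧ (fun _ : ℕ => (1 : ℝ)) i ≤ 1 := fun _ _ => ⟨le_rfl, le_rfl⟩
  refine ⟨?_, fun μ => ?_, fun μ => ?_⟩
  · have key := hA1 k Mh R hMh3 hM1a hR (hRM N₁ hN1m) P hP hP4 D (aPrinted ℓ 1) (fun _ => 1) hw hcw hrec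
    refine hasMajorant_mono (g := geomT D) (blkOf D.toDomains) key fun y y' => ?_
    have h1 : C₁ ≤ C := by rw [hC]; linarith
    have := hrate δ₁ (min_le_left _ _) y y'
    have hpow : (0 : ℝ) ≤ ((ℓ : ℝ) + 1) ^ (2 * y.1.1) := by positivity
    calc C₁ * ((ℓ : ℝ) + 1) ^ (2 * y.1.1) * Real.exp (-(δ₁ / 2 * (geomT D).dist y y'))
        ≤ C * ((ℓ : ℝ) + 1) ^ (2 * y.1.1) * Real.exp (-(δ₁ / 2 * (geomT D).dist y y')) :=
          mul_le_mul_of_nonneg_right (mul_le_mul_of_nonneg_right h1 hpow) (Real.exp_nonneg _)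
      _ ≤ C * ((ℓ : ℝ) + 1) ^ (2 * y.1.1) * Real.exp (-(δ * (geomT D).dist y y')) :=
          mul_le_mul_of_nonneg_left this (by positivity)
  · have key := hA2 k Mh R hMh3 hM2a hR (hRM N₂ hN2m) P hP hP4 D (aPrinted ℓ 1) (fun _ => 1) hw hcw hrec μ
    refine hasMajorant_mono (g := geomT D) (blkOf D.toDomains) key fun y y' => ?_
    have h1 : C₂ ≤ C := by rw [hC]; linarith
    have := hrate δ₂ (le_trans (min_le_right _ _) (min_le_left _ _)) y y'
    have hpow : (0 : ℝ) ≤ ((ℓ : ℝ) + 1) ^ y.1.1 := by positivity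
    calc C₂ * ((ℓ : ℝ) + 1) ^ y.1.1 * Real.exp (-(δ₂ / 2 * (geomT D).dist y y'))
        ≤ C * ((ℓ : ℝ) + 1) ^ y.1.1 * Real.exp (-(δ₂ / 2 * (geomT D).dist y y')) :=
          mul_le_mul_of_nonneg_right (mul_le_mul_of_nonneg_right h1 hpow) (Real.exp_nonneg _)
      _ ≤ C * ((ℓ : ℝ) + 1) ^ y.1.1 * Real.exp (-(δ * (geomT D).dist y y')) :=
          mul_le_mul_of_nonneg_left this (by positivity)
  · have key := hA3 k Mh R hMh3 hM3a hR (hRM N₃ hN3m) P hP hP4 D (aPrinted ℓ 1) (fun _ => 1) hw hcw hrec μ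
    refine hasMajorant_mono (g := geomT D) (blkOf D.toDomains) key fun y y' => ?_
    have h1 : C₃ ≤ C := by rw [hC]; linarith
    have := hrate δ₃ (le_trans (min_le_right _ _) (min_le_right _ _)) y y'
    have hpow : (0 : ℝ) ≤ ((ℓ : ℝ) + 1) ^ y.1.1 := by positivity
    calc C₃ * ((ℓ : ℝ) + 1) ^ y.1.1 * Real.exp (-(δ₃ / 2 * (geomT D).dist y y'))
        ≤ C * ((ℓ : ℝ) + 1) ^ y.1.1 * Real.exp (-(δ₃ / 2 * (geomT D).dist y y')) :=
          mul_le_mul_of_nonneg_right (mul_le_mul_of_nonneg_right h1 hpow) (Real.exp_nonneg _)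
      _ ≤ C * ((ℓ : ℝ) + 1) ^ y.1.1 * Real.exp (-(δ * (geomT D).dist y y')) :=
          mul_le_mul_of_nonneg_left this (by positivity)

/-- **PROPOSITION 2.3 (2.87) FOR THE GENUINE `k`-LEVEL `(Q′G′²Q′*)⁻¹` OF THE TORUS AT THE PRINTED WEIGHTS, AS AN ENTRY BOUND OF p21's `GiM`**:
`|GiM(y, y′)| ≤ C·(L^j)^{−4}·e^{−δd_T(y,y′)}` (`GiM(y, y′) = W(y′)·C(y, y′)`, `W(y′) = (L^{j′})^{d+1}` absorbs print's `(L^{j′}η)^{−d}`),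
above ONE threshold `M₁ ≤ L·M_h`, for `P_μ ≥ 4`, `R ≥ 2L`. [cite: Balaban1984PropagatorsII, Proposition 2.3 (2.87) p.238, (2.69) p.235] -/
theorem prop23_GiM_printed (d ℓ : ℕ) (hℓ : 1 ≤ ℓ) :
    ∃ M₁ δ C : ℝ, 0 < M₁ ∧ 0 < δ ∧ 0 < C ∧
      ∀ (k Mh R : ℕ), M₁ ≤ ((ℓ : ℝ) + 1) * Mh → 2 * (ℓ + 1) ≤ R →
      ∀ (P : Fin (d + 1) → ℕ) (_hP4 : ∀ μ, 4 ≤ P μ) (D : TDomains d ℓ Mh k P R) (y y' : ↥(bset D.toDomains)),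
        |GiM D y y'| ≤ C * (((ℓ : ℝ) + 1) ^ y.1.1) ^ (-(4 : ℤ)) * Real.exp (-(δ * (geomT D).dist y y')) := by
  set amin : ℝ := 1 - ((((ℓ : ℝ) + 1)) ^ 2)⁻¹ with hamin_def
  have hL2 : (1 : ℝ) < (((ℓ : ℝ) + 1)) ^ 2 := by
    have : (2 : ℝ) ≤ (ℓ : ℝ) + 1 := by
      have : (1 : ℝ) ≤ ℓ := by exact_mod_cast hℓ
      linarith
    nlinarith
  have hamin : 0 < amin := by rw [hamin_def, sub_pos]; exact inv_lt_one_of_one_lt₀ hL2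
  obtain ⟨hwin, hrec⟩ := B6Prop22KLevelCensus.KIdx.aPrinted_windows hℓ
  obtain ⟨δ₁, C, M₀, hδ₁, hC, hM₀, h⟩ := B6Prop23MultiLevelTorus.prop23_multiLevelTorus d ℓ hℓ amin 1 1 1 hamin one_pos
  refine ⟨M₀, δ₁ / 2, C, hM₀, half_pos hδ₁, hC, fun k Mh R hM hR P hP4 D y y' => ?_⟩
  have hP : ∀ μ, 1 ≤ P μ := fun μ => le_trans (by norm_num) (hP4 μ)
  have hcw : ∀ i, 1 ≤ i → (1 : ℝ) ≤ (fun _ : ℕ => (1 : ℝ)) i ∧ (fun _ : ℕ => (1 : ℝ)) i ≤ 1 := fun _ _ => ⟨le_rfl, le_rfl⟩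
  obtain ⟨-, -, -, hent⟩ := h k Mh R hM hR P hP hP4 D (aPrinted ℓ 1) (fun _ => 1) (fun i hi => hwin i hi) hcw hrec
  have h1 := hent y y'
  have hW : 0 < W D.toDomains y' := W_pos _ _
  have hL : (0 : ℝ) < (ℓ : ℝ) + 1 := by positivity
  -- `GiM(y, y′) = (mat GinvT)(y, y′)`; undo the division by `W(y′)` and rewrite the real powers
  have e1 : GiM D y y' = B6Prop23Chain.mat (B6Prop23MultiLevelTorus.GinvT D (aPrinted ℓ 1)) y y' / W D.toDomains y' * W D.toDomains y' := by
    unfold GiM; rw [div_mul_cancel₀ _ hW.ne']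
  rw [e1, abs_mul, abs_of_pos hW]
  have hlen : (geomT D).len y = ((ℓ : ℝ) + 1) ^ y.1.1 := B8Ineq192MultiLevelTorus.lenT_eq D y
  have hlen' : (geomT D).len y' = ((ℓ : ℝ) + 1) ^ y'.1.1 := B8Ineq192MultiLevelTorus.lenT_eq D y'
  have hly : (0 : ℝ) < ((ℓ : ℝ) + 1) ^ y.1.1 := by positivity
  have hly' : (0 : ℝ) < ((ℓ : ℝ) + 1) ^ y'.1.1 := by positivity
  have e2 : (geomT D).len y ^ (-(4 : ℝ)) = (((ℓ : ℝ) + 1) ^ y.1.1) ^ (-(4 : ℤ)) := by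
    rw [hlen, ← Real.rpow_intCast]; norm_num
  have e3 : (geomT D).len y' ^ (-((d + 1 : ℕ) : ℝ)) * W D.toDomains y' = 1 := by
    rw [hlen', W_eq, Real.rpow_neg hly'.le, Real.rpow_natCast, inv_mul_cancel₀ (pow_ne_zero _ hly'.ne')]
  calc |B6Prop23Chain.mat (B6Prop23MultiLevelTorus.GinvT D (aPrinted ℓ 1)) y y' / W D.toDomains y'| * W D.toDomains y'
      ≤ C * (geomT D).len y ^ (-(4 : ℝ)) * (geomT D).len y' ^ (-((d + 1 : ℕ) : ℝ)) * Real.exp (-(δ₁ / 2 * (geomT D).dist y y')) *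
          W D.toDomains y' := mul_le_mul_of_nonneg_right h1 hW.le
    _ = C * (((ℓ : ℝ) + 1) ^ y.1.1) ^ (-(4 : ℤ)) * Real.exp (-(δ₁ / 2 * (geomT D).dist y y')) := by
        rw [e2]
        calc C * (((ℓ : ℝ) + 1) ^ y.1.1) ^ (-(4 : ℤ)) * (geomT D).len y' ^ (-((d + 1 : ℕ) : ℝ)) *
              Real.exp (-(δ₁ / 2 * (geomT D).dist y y')) * W D.toDomains y'
            = C * (((ℓ : ℝ) + 1) ^ y.1.1) ^ (-(4 : ℤ)) * Real.exp (-(δ₁ / 2 * (geomT D).dist y y')) *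
                ((geomT D).len y' ^ (-((d + 1 : ℕ) : ℝ)) * W D.toDomains y') := by ring
          _ = _ := by rw [e3, mul_one]

/-- **THE BLOCK MAJORANT OF THE MIDDLE FACTOR `S = Q′*(Q′G′²Q′*)⁻¹Q′` ON THE TORUS**: from the entry bound of `GiM` and `#B(y′) ≤ W(y′)`:
`|(Sλ)(x)| ≤ C·(L^j)^{−4}·e^{−δd_T(y,y′)}·|λ|` for `x ∈ B(y)`, `supp λ ⊂ B(y′)` — print's (2.87) shape `(L^jη)^{−4}(L^{j′}η)^{−d}` summed over the block.
[cite: Balaban1984PropagatorsII, Proposition 2.3 (2.87) p.238, (2.17) p.225] -/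
theorem hasMajorant_S_matrix {C δ : ℝ} {D : TDomains d ℓ Mh k P' R} (hC : 0 ≤ C)
    (hG : ∀ y y' : ↥(bset D.toDomains), |GiM D y y'| ≤ C * (((ℓ : ℝ) + 1) ^ y.1.1) ^ (-(4 : ℤ)) * Real.exp (-(δ * (geomT D).dist y y'))) :
    HasMajorant (g := geomT D) (blkOf D.toDomains) (Matrix.toLin' (QsM D * GiM D * QM D))
      (fun y y' => C * (((ℓ : ℝ) + 1) ^ y.1.1) ^ (-(4 : ℤ)) * Real.exp (-(δ * (geomT D).dist y y'))) := by
  classical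
  intro y' g B hg x
  rw [Matrix.toLin'_apply, Matrix.mulVec, dotProduct]
  simp only [S_entry]
  -- restrict the sum to the block `y′`
  have hsplit : ∑ x', GiM D (blkOf D.toDomains x) (blkOf D.toDomains x') * (W D.toDomains (blkOf D.toDomains x'))⁻¹ * g x' =
      ∑ x' ∈ Finset.univ.filter (fun x' => blkOf D.toDomains x' = y'),
        GiM D (blkOf D.toDomains x) y' * (W D.toDomains y')⁻¹ * g x' := by
    rw [← Finset.sum_filter_add_sum_filter_not Finset.univ (fun x' => blkOf D.toDomains x' = y')]
    have hz : ∑ x' ∈ Finset.univ.filter (fun x' => ¬ blkOf D.toDomains x' = y'),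
        GiM D (blkOf D.toDomains x) (blkOf D.toDomains x') * (W D.toDomains (blkOf D.toDomains x'))⁻¹ * g x' = 0 :=
      Finset.sum_eq_zero fun x' hx' => by rw [Finset.mem_filter] at hx'; rw [hg.off x' hx'.2, mul_zero]
    rw [hz, add_zero]
    exact Finset.sum_congr rfl fun x' hx' => by rw [Finset.mem_filter] at hx'; rw [hx'.2]
  rw [hsplit, ← Finset.mul_sum]
  have hW : 0 < W D.toDomains y' := W_pos _ _
  have hsum : |∑ x' ∈ Finset.univ.filter (fun x' => blkOf D.toDomains x' = y'), g x'| ≤ W D.toDomains y' * B := by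
    refine (Finset.abs_sum_le_sum_abs _ _).trans ?_
    refine (Finset.sum_le_sum fun x' hx' => hg.bound x' (by rw [Finset.mem_filter] at hx'; exact hx'.2)).trans ?_
    rw [Finset.sum_const, nsmul_eq_mul]
    exact mul_le_mul_of_nonneg_right (card_blkOf_le D.toDomains y') hg.nonneg
  rw [abs_mul, abs_mul, abs_of_pos (inv_pos.2 hW)]
  calc |GiM D (blkOf D.toDomains x) y'| * (W D.toDomains y')⁻¹ * |∑ x' ∈ Finset.univ.filter (fun x' => blkOf D.toDomains x' = y'), g x'|
      ≤ (C * (((ℓ : ℝ) + 1) ^ (blkOf D.toDomains x).1.1) ^ (-(4 : ℤ)) * Real.exp (-(δ * (geomT D).dist (blkOf D.toDomains x) y'))) *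
          (W D.toDomains y')⁻¹ * (W D.toDomains y' * B) :=
        mul_le_mul (mul_le_mul_of_nonneg_right (hG _ _) (inv_pos.2 hW).le) hsum (abs_nonneg _)
          (mul_nonneg (by positivity) (inv_pos.2 hW).le)
    _ = C * (((ℓ : ℝ) + 1) ^ (blkOf D.toDomains x).1.1) ^ (-(4 : ℤ)) * Real.exp (-(δ * (geomT D).dist (blkOf D.toDomains x) y')) * B := by
        field_simp

end Printed

/-! ## §5  The displayed inputs of the line-3 domain change on the V1 carrier: majorants of `G′`, `∂G′`, `G′∂*`, `S` -/

section V1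

/-- **THE FOUR FACTOR MAJORANTS ON THE V1 GLOBAL TORUS, ONE THRESHOLD** (the displayed inputs of p38's `B6DomainChangeP2134` sizes for the
GLOBAL five-factor `P = G′SG′`; for the member apply to `D := B6MemberTorusTDomainsV1.famOf …` and transplant): there are `M₁, δ, C > 0` (on `d, L`)
such that for every V1 global torus (`hN`), every torus family `D` with `P_μ ≥ 4`, `R ≥ 2L`, `M₁ ≤ L·M_h`, and every fine factor `c ≠ 0`:
`G′ = GpV`: `HasMajorant blkS (c⁻²·C·len(y)²·e^{−δd})`; `∂_cG′`: `HasMajorantHom blkS blkV1 (|c|⁻¹·C·len(y)·e^{−δd})`; `G′∂_c*`: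
`HasMajorantHom blkV1 blkS ((d+1)|c|⁻¹·C·len(y)·e^{−δd})`; `S = SV`: `HasMajorant blkS (c⁴·C·len(y)⁻⁴·e^{−δd})` — all on `geomT D`, `len(y) = L^j`.
[cite: Balaban1984PropagatorsII, Proposition 2.2 (2.67) p.234, Proposition 2.3 (2.87) p.238, (2.17) p.225] -/
theorem factors_V1 (d ℓ : ℕ) (hd : 1 ≤ d + 1) (hL : Odd (ℓ + 1) ∧ 1 < ℓ + 1) :
    ∃ M₁ δ C : ℝ, 0 < M₁ ∧ 0 < δ ∧ 0 < C ∧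
      ∀ (m K : ℕ) {Mh k R : ℕ} {P' : Fin (d + 1) → ℕ} (hN : ∀ μ, N0 ℓ Mh k P' μ = (PV d ℓ m K hd hL).sitesPerDir 0)
        (D : TDomains d ℓ Mh k P' R), (∀ μ, 4 ≤ P' μ) → 2 * (ℓ + 1) ≤ R → M₁ ≤ ((ℓ : ℝ) + 1) * Mh →
        ∀ {c : ℝ}, c ≠ 0 →
          HasMajorant (g := geomT D) (blkS hN D) (GpV hN D c)
            (fun y y' => (c ^ 2)⁻¹ * C * (geomT D).len y ^ 2 * Real.exp (-(δ * (geomT D).dist y y'))) ∧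
          HasMajorantHom (g := geomT D) (blkS hN D) (blkV1 hN D) (onFun (dE c) ∘ₗ GpV hN D c)
            (fun y y' => |c|⁻¹ * C * (geomT D).len y * Real.exp (-(δ * (geomT D).dist y y'))) ∧
          HasMajorantHom (g := geomT D) (blkV1 hN D) (blkS hN D) (GpV hN D c ∘ₗ onFun (dsE c))
            (fun y y' => ((d : ℝ) + 1) * |c|⁻¹ * C * (geomT D).len y * Real.exp (-(δ * (geomT D).dist y y'))) ∧
          HasMajorant (g := geomT D) (blkS hN D) (SV hN D c)
            (fun y y' => c ^ 4 * C * ((geomT D).len y ^ 4)⁻¹ * Real.exp (-(δ * (geomT D).dist y y'))) := by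
  have hℓ : 1 ≤ ℓ := by have := hL.2; omega
  obtain ⟨M₁, δ₁, C₁, hM₁, hδ₁, hC₁, h22⟩ := prop22_entries_printed d ℓ hℓ
  obtain ⟨M₂, δ₂, C₂, hM₂, hδ₂, hC₂, h23⟩ := prop23_GiM_printed d ℓ hℓ
  refine ⟨max M₁ M₂, min δ₁ δ₂, max C₁ C₂, lt_max_iff.2 (Or.inl hM₁), lt_min hδ₁ hδ₂, lt_max_iff.2 (Or.inl hC₁), ?_⟩
  intro m K Mh k R P' hN D hP4 hR hM c hc
  have hP : ∀ μ, 1 ≤ P' μ := fun μ => le_trans (by norm_num) (hP4 μ)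
  have hMh1 : 1 ≤ Mh := by
    by_contra h0
    have : Mh = 0 := by omega
    rw [this, Nat.cast_zero, mul_zero] at hM
    linarith [le_max_left M₁ M₂]
  obtain ⟨hG, hdG, hGd⟩ := h22 k Mh R ((le_max_left _ _).trans hM) hR P' hP4 D
  have hGi := h23 k Mh R ((le_max_right _ _).trans hM) hR P' hP4 D
  have hdnn : ∀ y y' : ↥(bset D.toDomains), 0 ≤ (geomT D).dist y y' :=
    (B6Geom246MultiLevelTorus.triangle_refl_nonneg_T D hMh1 hP).2.2
  have hlen : ∀ y : ↥(bset D.toDomains), (geomT D).len y = ((ℓ : ℝ) + 1) ^ y.1.1 := B8Ineq192MultiLevelTorus.lenT_eq D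
  have hexp1 : ∀ y y' : ↥(bset D.toDomains), Real.exp (-(δ₁ * (geomT D).dist y y')) ≤ Real.exp (-(min δ₁ δ₂ * (geomT D).dist y y')) :=
    fun y y' => by rw [Real.exp_le_exp, neg_le_neg_iff]; exact mul_le_mul_of_nonneg_right (min_le_left _ _) (hdnn y y')
  have hexp2 : ∀ y y' : ↥(bset D.toDomains), Real.exp (-(δ₂ * (geomT D).dist y y')) ≤ Real.exp (-(min δ₁ δ₂ * (geomT D).dist y y')) :=
    fun y y' => by rw [Real.exp_le_exp, neg_le_neg_iff]; exact mul_le_mul_of_nonneg_right (min_le_right _ _) (hdnn y y')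
  have hC1 : C₁ ≤ max C₁ C₂ := le_max_left _ _
  have hC2 : C₂ ≤ max C₁ C₂ := le_max_right _ _
  have hc2 : 0 < (c ^ 2)⁻¹ := inv_pos.2 (by positivity)
  have hca : 0 < |c|⁻¹ := inv_pos.2 (abs_pos.2 hc)
  refine ⟨?_, ?_, ?_, ?_⟩
  · -- `G′ = c⁻²·GT^`
    unfold GpV
    intro y' μ B hμ x
    dsimp only
    have h1 := hasMajorant_chartOp hN D hG y' μ B hμ x
    rw [LinearMap.smul_apply, Pi.smul_apply, smul_eq_mul, abs_mul, abs_of_pos hc2]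
    refine (mul_le_mul_of_nonneg_left h1 hc2.le).trans ?_
    rw [hlen, ← mul_assoc]
    have hpow : (0 : ℝ) ≤ ((ℓ : ℝ) + 1) ^ (2 * (blkS hN D x).1.1) := by positivity
    have e : (((ℓ : ℝ) + 1) ^ (blkS hN D x).1.1) ^ 2 = ((ℓ : ℝ) + 1) ^ (2 * (blkS hN D x).1.1) := by rw [← pow_mul, mul_comm]
    rw [e]
    refine mul_le_mul_of_nonneg_right ?_ hμ.nonneg
    calc (c ^ 2)⁻¹ * (C₁ * ((ℓ : ℝ) + 1) ^ (2 * (blkS hN D x).1.1) * Real.exp (-(δ₁ * (geomT D).dist (blkS hN D x) y')))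
        ≤ (c ^ 2)⁻¹ * (max C₁ C₂ * ((ℓ : ℝ) + 1) ^ (2 * (blkS hN D x).1.1) * Real.exp (-(min δ₁ δ₂ * (geomT D).dist (blkS hN D x) y'))) :=
          mul_le_mul_of_nonneg_left (mul_le_mul (mul_le_mul_of_nonneg_right hC1 hpow) (hexp1 _ _) (Real.exp_nonneg _)
            (mul_nonneg (hC1.trans' hC₁.le) hpow)) hc2.le
      _ = (c ^ 2)⁻¹ * max C₁ C₂ * ((ℓ : ℝ) + 1) ^ (2 * (blkS hN D x).1.1) * Real.exp (-(min δ₁ δ₂ * (geomT D).dist (blkS hN D x) y')) := by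
          ring
  · -- the left leg `∂_cG′`
    unfold GpV
    have h1 := hasMajorantHom_dE_chartOp hN D c (M := GT D) hdG
    intro y' μ B hμ b
    dsimp only
    have h2 := h1 y' μ B hμ b
    rw [LinearMap.comp_smul, LinearMap.smul_apply, Pi.smul_apply, smul_eq_mul, abs_mul, abs_of_pos hc2]
    refine (mul_le_mul_of_nonneg_left h2 hc2.le).trans ?_
    rw [hlen]
    have hpow : (0 : ℝ) ≤ ((ℓ : ℝ) + 1) ^ (blkV1 hN D b).1.1 := by positivity
    have e : (c ^ 2)⁻¹ * |c| = |c|⁻¹ := by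
      rw [show c ^ 2 = |c| ^ 2 by rw [sq_abs]]; field_simp
    refine le_of_eq_of_le ?_ (mul_le_mul_of_nonneg_right (?_ : (c ^ 2)⁻¹ * (|c| * (C₁ * ((ℓ : ℝ) + 1) ^ (blkV1 hN D b).1.1 *
        Real.exp (-(δ₁ * (geomT D).dist (blkV1 hN D b) y')))) ≤ _) hμ.nonneg)
    · ring
    calc (c ^ 2)⁻¹ * (|c| * (C₁ * ((ℓ : ℝ) + 1) ^ (blkV1 hN D b).1.1 * Real.exp (-(δ₁ * (geomT D).dist (blkV1 hN D b) y'))))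
        = |c|⁻¹ * (C₁ * ((ℓ : ℝ) + 1) ^ (blkV1 hN D b).1.1 * Real.exp (-(δ₁ * (geomT D).dist (blkV1 hN D b) y'))) := by
          rw [← mul_assoc, e]
      _ ≤ |c|⁻¹ * (max C₁ C₂ * ((ℓ : ℝ) + 1) ^ (blkV1 hN D b).1.1 * Real.exp (-(min δ₁ δ₂ * (geomT D).dist (blkV1 hN D b) y'))) :=
          mul_le_mul_of_nonneg_left (mul_le_mul (mul_le_mul_of_nonneg_right hC1 hpow) (hexp1 _ _) (Real.exp_nonneg _)
            (mul_nonneg (hC1.trans' hC₁.le) hpow)) hca.le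
      _ = |c|⁻¹ * max C₁ C₂ * ((ℓ : ℝ) + 1) ^ (blkV1 hN D b).1.1 * Real.exp (-(min δ₁ δ₂ * (geomT D).dist (blkV1 hN D b) y')) := by ring
  · -- the right leg `G′∂_c*`
    unfold GpV
    have h1 := hasMajorantHom_chartOp_dsE hN D c (M := GT D) hGd
    intro y' A B hA x
    dsimp only
    have h2 := h1 y' A B hA x
    rw [LinearMap.smul_comp, LinearMap.smul_apply, Pi.smul_apply, smul_eq_mul, abs_mul, abs_of_pos hc2]
    refine (mul_le_mul_of_nonneg_left h2 hc2.le).trans ?_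
    rw [hlen]
    have hpow : (0 : ℝ) ≤ ((ℓ : ℝ) + 1) ^ (blkS hN D x).1.1 := by positivity
    have e : (c ^ 2)⁻¹ * |c| = |c|⁻¹ := by
      rw [show c ^ 2 = |c| ^ 2 by rw [sq_abs]]; field_simp
    have hd1 : (0 : ℝ) ≤ (d : ℝ) + 1 := by positivity
    refine le_of_eq_of_le ?_ (mul_le_mul_of_nonneg_right (?_ : (c ^ 2)⁻¹ * (((d : ℝ) + 1) * |c| * (C₁ * ((ℓ : ℝ) + 1) ^ (blkS hN D x).1.1 *
        Real.exp (-(δ₁ * (geomT D).dist (blkS hN D x) y')))) ≤ _) hA.nonneg)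
    · ring
    calc (c ^ 2)⁻¹ * (((d : ℝ) + 1) * |c| * (C₁ * ((ℓ : ℝ) + 1) ^ (blkS hN D x).1.1 * Real.exp (-(δ₁ * (geomT D).dist (blkS hN D x) y'))))
        = ((d : ℝ) + 1) * |c|⁻¹ * (C₁ * ((ℓ : ℝ) + 1) ^ (blkS hN D x).1.1 * Real.exp (-(δ₁ * (geomT D).dist (blkS hN D x) y'))) := by
          rw [show (c ^ 2)⁻¹ * (((d : ℝ) + 1) * |c| * (C₁ * ((ℓ : ℝ) + 1) ^ (blkS hN D x).1.1 *
              Real.exp (-(δ₁ * (geomT D).dist (blkS hN D x) y')))) =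
            ((d : ℝ) + 1) * ((c ^ 2)⁻¹ * |c|) * (C₁ * ((ℓ : ℝ) + 1) ^ (blkS hN D x).1.1 *
              Real.exp (-(δ₁ * (geomT D).dist (blkS hN D x) y'))) by ring, e]
      _ ≤ ((d : ℝ) + 1) * |c|⁻¹ * (max C₁ C₂ * ((ℓ : ℝ) + 1) ^ (blkS hN D x).1.1 * Real.exp (-(min δ₁ δ₂ * (geomT D).dist (blkS hN D x) y'))) :=
          mul_le_mul_of_nonneg_left (mul_le_mul (mul_le_mul_of_nonneg_right hC1 hpow) (hexp1 _ _) (Real.exp_nonneg _)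
            (mul_nonneg (hC1.trans' hC₁.le) hpow)) (mul_nonneg hd1 hca.le)
      _ = ((d : ℝ) + 1) * |c|⁻¹ * max C₁ C₂ * ((ℓ : ℝ) + 1) ^ (blkS hN D x).1.1 *
            Real.exp (-(min δ₁ δ₂ * (geomT D).dist (blkS hN D x) y')) := by ring
  · -- `S = c⁴·(QsM GiM QM)^`
    unfold SV
    have hS := hasMajorant_S_matrix (ℓ := ℓ) hC₂.le hGi
    intro y' μ B hμ x
    dsimp only
    have h1 := hasMajorant_chartOp hN D hS y' μ B hμ x
    have hc4 : 0 < c ^ 4 := by positivity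
    rw [LinearMap.smul_apply, Pi.smul_apply, smul_eq_mul, abs_mul, abs_of_pos hc4]
    refine (mul_le_mul_of_nonneg_left h1 hc4.le).trans ?_
    rw [hlen, ← mul_assoc]
    have hly : (0 : ℝ) < ((ℓ : ℝ) + 1) ^ (blkS hN D x).1.1 := by positivity
    have e : (((ℓ : ℝ) + 1) ^ (blkS hN D x).1.1) ^ (-(4 : ℤ)) = ((((ℓ : ℝ) + 1) ^ (blkS hN D x).1.1) ^ 4)⁻¹ := by
      rw [zpow_neg, zpow_ofNat]
    rw [e]
    have hpow : (0 : ℝ) ≤ ((((ℓ : ℝ) + 1) ^ (blkS hN D x).1.1) ^ 4)⁻¹ := by positivity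
    refine mul_le_mul_of_nonneg_right ?_ hμ.nonneg
    calc c ^ 4 * (C₂ * ((((ℓ : ℝ) + 1) ^ (blkS hN D x).1.1) ^ 4)⁻¹ * Real.exp (-(δ₂ * (geomT D).dist (blkS hN D x) y')))
        ≤ c ^ 4 * (max C₁ C₂ * ((((ℓ : ℝ) + 1) ^ (blkS hN D x).1.1) ^ 4)⁻¹ * Real.exp (-(min δ₁ δ₂ * (geomT D).dist (blkS hN D x) y'))) :=
          mul_le_mul_of_nonneg_left (mul_le_mul (mul_le_mul_of_nonneg_right hC2 hpow) (hexp2 _ _) (Real.exp_nonneg _)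
            (mul_nonneg (hC2.trans' hC₂.le) hpow)) hc4.le
      _ = c ^ 4 * max C₁ C₂ * ((((ℓ : ℝ) + 1) ^ (blkS hN D x).1.1) ^ 4)⁻¹ * Real.exp (-(min δ₁ δ₂ * (geomT D).dist (blkS hN D x) y')) := by
          ring

/-- **THE SAME OVER B8's `geomTB D`** — the literal geometry of p38's `h2134_kFam_torus` binders (`geomTB` and `geomT` have the same sites, lengths
and distance). [cite: Balaban1984PropagatorsII, Proposition 2.2 (2.67) p.234, Proposition 2.3 (2.87) p.238, (2.134) p.247] -/
theorem factors_V1_TB (d ℓ : ℕ) (hd : 1 ≤ d + 1) (hL : Odd (ℓ + 1) ∧ 1 < ℓ + 1) :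
    ∃ M₁ δ C : ℝ, 0 < M₁ ∧ 0 < δ ∧ 0 < C ∧
      ∀ (m K : ℕ) {Mh k R : ℕ} {P' : Fin (d + 1) → ℕ} (hN : ∀ μ, N0 ℓ Mh k P' μ = (PV d ℓ m K hd hL).sitesPerDir 0)
        (D : TDomains d ℓ Mh k P' R), (∀ μ, 4 ≤ P' μ) → 2 * (ℓ + 1) ≤ R → M₁ ≤ ((ℓ : ℝ) + 1) * Mh →
        ∀ {c : ℝ}, c ≠ 0 →
          HasMajorant (g := geomTB D) (blkS hN D) (GpV hN D c)
            (fun y y' => (c ^ 2)⁻¹ * C * (geomTB D).len y ^ 2 * Real.exp (-(δ * (geomTB D).dist y y'))) ∧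
          HasMajorantHom (g := geomTB D) (blkS hN D) (blkV1 hN D) (onFun (dE c) ∘ₗ GpV hN D c)
            (fun y y' => |c|⁻¹ * C * (geomTB D).len y * Real.exp (-(δ * (geomTB D).dist y y'))) ∧
          HasMajorantHom (g := geomTB D) (blkV1 hN D) (blkS hN D) (GpV hN D c ∘ₗ onFun (dsE c))
            (fun y y' => ((d : ℝ) + 1) * |c|⁻¹ * C * (geomTB D).len y * Real.exp (-(δ * (geomTB D).dist y y'))) ∧
          HasMajorant (g := geomTB D) (blkS hN D) (SV hN D c)
            (fun y y' => c ^ 4 * C * ((geomTB D).len y ^ 4)⁻¹ * Real.exp (-(δ * (geomTB D).dist y y'))) := by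
  obtain ⟨M₁, δ, C, hM₁, hδ, hC, h⟩ := factors_V1 d ℓ hd hL
  refine ⟨M₁, δ, C, hM₁, hδ, hC, fun m K Mh k R P' hN D hP4 hR hM c hc => ?_⟩
  obtain ⟨h1, h2, h3, h4⟩ := h m K hN D hP4 hR hM hc
  refine ⟨?_, ?_, ?_, ?_⟩
  · intro y' μ B hB x
    simpa only [B8Ineq192MultiLevelTorus.geomTB_dist, B8Ineq192MultiLevelTorus.geomTB_len, B8Ineq192MultiLevelTorus.geomT_len] using
      h1 y' μ B ⟨hB.nonneg, hB.bound, hB.off⟩ x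
  · intro y' μ B hB b
    simpa only [B8Ineq192MultiLevelTorus.geomTB_dist, B8Ineq192MultiLevelTorus.geomTB_len, B8Ineq192MultiLevelTorus.geomT_len] using
      h2 y' μ B ⟨hB.nonneg, hB.bound, hB.off⟩ b
  · intro y' A B hA x
    simpa only [B8Ineq192MultiLevelTorus.geomTB_dist, B8Ineq192MultiLevelTorus.geomTB_len, B8Ineq192MultiLevelTorus.geomT_len] using
      h3 y' A B ⟨hA.nonneg, hA.bound, hA.off⟩ x
  · intro y' μ B hB x
    simpa only [B8Ineq192MultiLevelTorus.geomTB_dist, B8Ineq192MultiLevelTorus.geomTB_len, B8Ineq192MultiLevelTorus.geomT_len] using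
      h4 y' μ B ⟨hB.nonneg, hB.bound, hB.off⟩ x

end V1

end Literature.MathematicalPhysics.QuantumFieldTheory.Balaban1983to89.B6ScalarFactorsChartV1

end
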